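import Literature.Topology.FourManifolds.GroupTrisections
import HarnessLib

/-!
# `S_{g+h}` is the amalgam of `F⟨a₁, …, b_g⟩` and `F⟨a₁, …, b_h⟩` over `ℤ`; `F_{g+h}` is their free product

Topic `Literature/Topology/FourManifolds`; algebra for the fact seat
`provefact-Literature.Topology.FourManifolds.exists-cbed50d78a` (named fact (g′)
`Literature.Topology.FourManifolds.exists_marking_centralSurface_of_gkTrisection`: the central
surface of a `(g, k)`-trisection is marked by the surface group `S_g`).  The marking of the
explicit genus-`g` model surface (`FlowerHandlebody.lean` and sequels) is computed by
Seifert–van Kampen along a "melon" decomposition into `g` one-holed tori meeting in arcs, the last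
two pieces meeting in a circle; the group theory this needs is recorded here, for general `g + h`
(the tree's `TrisectionFunctorGKStabilizationKernel.lean` has the case `h = 3`,
`surfaceGroup_exists_mulEquiv_of_pushout`, for the stabilisation of trisections):

* `genInclAdd g h`, `genShiftAdd g h` — the two inclusions of generators
  `F⟨a₁,…,b_g⟩ → F⟨a₁,…,b_{g+h}⟩ ← F⟨a₁,…,b_h⟩` (`rfl`-equal to `genIncl`, `genShift` for `h = 3`);
  `surfaceRelator_add : r_{g+h} = ι(r_g) · σ(r_h)`;
* `freeGroup_exists_mulEquiv_of_coproduct` — if `(Γ; u, v)` has the universal property of the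
  coproduct of the two free groups then `Γ ≅ F⟨a₁,…,b_{g+h}⟩` compatibly (van Kampen for two
  pieces glued along a simply connected set);
* `surfaceGroup_exists_mulEquiv_of_pushout_add` — if `u(r_g) · v(r_h) = 1` and `(Γ; u, v)` has
  the universal property of the pushout over `ℤ` (`1 ↦ r_g`, `1 ↦ r_h⁻¹`) then `Γ ≅ S_{g+h}`
  compatibly (van Kampen for two pieces glued along a circle reading `r_g` and `r_h⁻¹`);
  with `surfaceGroup_hom_ext_add` (uniqueness) and `surfaceGroup_exists_hom_add` (existence);
  (`r₁ = a b a⁻¹ b⁻¹` is `surfaceRelator_one` of `SurfaceGroupGenusOne.lean`).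

Pure group theory over `GroupTrisections.lean` (`SurfaceGroup`, `surfaceRelator`,
`presentedLift`); everything is proved, no named facts.

## References

* A. Hatcher, *Algebraic Topology*, CUP (2002), §1.2: Thm. 1.20 (Seifert–van Kampen) and p. 51
  (`π₁(Σ_g)`). [HatcherAT2002]
-/

noncomputable section

open Set Subgroup

namespace Literature.Topology.FourManifolds

variable {g h : ℕ}

/-! ### The two inclusions of generators -/

/-- The inclusion of the first `g` handles: `aᵢ ↦ aᵢ`, `bᵢ ↦ bᵢ` (`i < g`), on free groups.
[folklore] -/
def genInclAdd (g h : ℕ) : FreeGroup (surfaceGen g) →* FreeGroup (surfaceGen (g + h)) :=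
  FreeGroup.map fun p => (Fin.castAdd h p.1, p.2)

/-- The shift onto the last `h` handles: `aⱼ ↦ a_{g+j}`, `bⱼ ↦ b_{g+j}`, on free groups. [folklore] -/
def genShiftAdd (g h : ℕ) : FreeGroup (surfaceGen h) →* FreeGroup (surfaceGen (g + h)) :=
  FreeGroup.map fun p => (Fin.natAdd g p.1, p.2)

/-- `genInclAdd` on a generator. [folklore] -/
@[simp] theorem genInclAdd_of (p : surfaceGen g) :
    genInclAdd g h (FreeGroup.of p) = FreeGroup.of (Fin.castAdd h p.1, p.2) := by
  simp [genInclAdd, FreeGroup.map.of]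

/-- `genShiftAdd` on a generator. [folklore] -/
@[simp] theorem genShiftAdd_of (p : surfaceGen h) :
    genShiftAdd g h (FreeGroup.of p) = FreeGroup.of (Fin.natAdd g p.1, p.2) := by
  simp [genShiftAdd, FreeGroup.map.of]

/-- The genus-`(g+3)` inclusion of `GroupTrisections.lean` is the case `h = 3`. [folklore] -/
theorem genIncl_eq_genInclAdd (g : ℕ) : genIncl g = genInclAdd g 3 := rfl

/-- The genus-`(g+3)` shift of `GroupTrisections.lean` is the case `h = 3`. [folklore] -/
theorem genShift_eq_genShiftAdd (g : ℕ) : genShift g = genShiftAdd g 3 := rfl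

/-- **`r_{g+h} = ι(r_g) · σ(r_h)`** in the free group on the genus-`(g+h)` generators. [folklore] -/
theorem surfaceRelator_add (g h : ℕ) :
    surfaceRelator (g + h) = genInclAdd g h (surfaceRelator g) * genShiftAdd g h (surfaceRelator h) := by
  simp only [surfaceRelator, map_list_prod, List.map_ofFn, ← List.prod_append, ← List.ofFn_eq_map]
  rw [← List.ofFn_fin_append]
  refine congrArg List.prod (congrArg List.ofFn ((Fin.append_castAdd_natAdd).symm.trans ?_))
  congr 1

/-- Every generator of `F⟨a₁, …, b_{g+h}⟩` is one of the first `g` handles or one of the last `h`.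
[folklore] -/
theorem of_eq_genInclAdd_or_genShiftAdd (p : surfaceGen (g + h)) :
    (∃ q : surfaceGen g, FreeGroup.of p = genInclAdd g h (FreeGroup.of q)) ∨
      (∃ q : surfaceGen h, FreeGroup.of p = genShiftAdd g h (FreeGroup.of q)) := by
  obtain ⟨i, b⟩ := p
  induction i using Fin.addCases with
  | left i => exact Or.inl ⟨(i, b), by simp⟩
  | right j => exact Or.inr ⟨(j, b), by simp⟩

/-- Two homomorphisms out of `F⟨a₁, …, b_{g+h}⟩` agreeing on the first `g` and on the last `h`
handles are equal. [folklore] -/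
theorem freeGroup_hom_ext_add {M : Type*} [Monoid M] {E E' : FreeGroup (surfaceGen (g + h)) →* M}
    (h₁ : E.comp (genInclAdd g h) = E'.comp (genInclAdd g h))
    (h₂ : E.comp (genShiftAdd g h) = E'.comp (genShiftAdd g h)) : E = E' := by
  refine FreeGroup.ext_hom _ _ fun p => ?_
  rcases of_eq_genInclAdd_or_genShiftAdd p with ⟨q, hq⟩ | ⟨q, hq⟩
  · rw [hq]; exact DFunLike.congr_fun h₁ (FreeGroup.of q)
  · rw [hq]; exact DFunLike.congr_fun h₂ (FreeGroup.of q)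

/-- **Free extension**: homomorphisms `u` on the first `g` handles and `v` on the last `h` extend
(uniquely) to `F⟨a₁, …, b_{g+h}⟩`. [folklore] -/
def freeExtend {T : Type*} [Group T] (u : FreeGroup (surfaceGen g) →* T) (v : FreeGroup (surfaceGen h) →* T) :
    FreeGroup (surfaceGen (g + h)) →* T :=
  FreeGroup.lift fun p => Fin.addCases (motive := fun _ => T) (fun i => u (FreeGroup.of (i, p.2)))
    (fun j => v (FreeGroup.of (j, p.2))) p.1

/-- The free extension restricted to the first `g` handles. [folklore] -/
@[simp] theorem freeExtend_comp_genInclAdd {T : Type*} [Group T] (u : FreeGroup (surfaceGen g) →* T)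
    (v : FreeGroup (surfaceGen h) →* T) : (freeExtend u v).comp (genInclAdd g h) = u :=
  FreeGroup.ext_hom _ _ fun q => by simp [freeExtend]

/-- The free extension restricted to the last `h` handles. [folklore] -/
@[simp] theorem freeExtend_comp_genShiftAdd {T : Type*} [Group T] (u : FreeGroup (surfaceGen g) →* T)
    (v : FreeGroup (surfaceGen h) →* T) : (freeExtend u v).comp (genShiftAdd g h) = v :=
  FreeGroup.ext_hom _ _ fun q => by simp [freeExtend]

/-! ### The free group of genus `g + h` is the coproduct -/

/-- **`F⟨a₁, …, b_{g+h}⟩` is the free product of `F⟨a₁,…,b_g⟩` and `F⟨a₁,…,b_h⟩`** (via `ι`, `σ`):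
if `(Γ; u, v)` has the universal property of the coproduct — (existence) some `F : Γ → F_{g+h}`
with `F ∘ u = ι`, `F ∘ v = σ`, and (uniqueness) endomorphisms of `Γ` agreeing on `u` and `v` are
equal — then there is an isomorphism `e : F_{g+h} ≃* Γ` with `e ∘ ι = u`, `e ∘ σ = v`.  (Van
Kampen for two pieces with simply connected intersection.) [cite: HatcherAT2002, Thm. 1.20] -/
theorem freeGroup_exists_mulEquiv_of_coproduct {Γ : Type*} [Group Γ]
    (u : FreeGroup (surfaceGen g) →* Γ) (v : FreeGroup (surfaceGen h) →* Γ)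
    (hexists : ∃ F : Γ →* FreeGroup (surfaceGen (g + h)), F.comp u = genInclAdd g h ∧ F.comp v = genShiftAdd g h)
    (hunique : ∀ F F' : Γ →* Γ, F.comp u = F'.comp u → F.comp v = F'.comp v → F = F') :
    ∃ e : FreeGroup (surfaceGen (g + h)) ≃* Γ,
      e.toMonoidHom.comp (genInclAdd g h) = u ∧ e.toMonoidHom.comp (genShiftAdd g h) = v := by
  obtain ⟨F, hF₁, hF₂⟩ := hexists
  have h1 : F.comp (freeExtend u v) = MonoidHom.id _ := by
    refine freeGroup_hom_ext_add ?_ ?_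
    · rw [MonoidHom.comp_assoc, freeExtend_comp_genInclAdd, hF₁, MonoidHom.id_comp]
    · rw [MonoidHom.comp_assoc, freeExtend_comp_genShiftAdd, hF₂, MonoidHom.id_comp]
  have h2 : (freeExtend u v).comp F = MonoidHom.id _ := by
    refine hunique _ _ ?_ ?_
    · rw [MonoidHom.comp_assoc, hF₁, freeExtend_comp_genInclAdd, MonoidHom.id_comp]
    · rw [MonoidHom.comp_assoc, hF₂, freeExtend_comp_genShiftAdd, MonoidHom.id_comp]
  exact ⟨MonoidHom.toMulEquiv (freeExtend u v) F h1 h2, freeExtend_comp_genInclAdd u v,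
    freeExtend_comp_genShiftAdd u v⟩

/-! ### `S_{g+h}` is the pushout over `ℤ` -/

/-- **Uniqueness.**  Two homomorphisms out of `S_{g+h}` agreeing on the first `g` handles
(`ι = mk ∘ genInclAdd`) and on the last `h` (`σ = mk ∘ genShiftAdd`) are equal. [folklore] -/
theorem surfaceGroup_hom_ext_add {M : Type*} [Monoid M] {φ χ : SurfaceGroup (g + h) →* M}
    (h₁ : φ.comp ((PresentedGroup.mk _).comp (genInclAdd g h)) = χ.comp ((PresentedGroup.mk _).comp (genInclAdd g h)))
    (h₂ : φ.comp ((PresentedGroup.mk _).comp (genShiftAdd g h)) = χ.comp ((PresentedGroup.mk _).comp (genShiftAdd g h))) :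
    φ = χ := by
  have hh : φ.comp (PresentedGroup.mk _) = χ.comp (PresentedGroup.mk _) :=
    freeGroup_hom_ext_add
      (by rw [MonoidHom.comp_assoc, MonoidHom.comp_assoc]; exact h₁)
      (by rw [MonoidHom.comp_assoc, MonoidHom.comp_assoc]; exact h₂)
  refine MonoidHom.ext fun x => ?_
  obtain ⟨x, rfl⟩ := PresentedGroup.mk_surjective _ x
  exact DFunLike.congr_fun hh x

/-- **Existence.**  Homomorphisms `u : F⟨a₁, …, b_g⟩ → T` and `v : F⟨a₁, …, b_h⟩ → T` with
`u(r_g) · v(r_h) = 1` extend to `m : S_{g+h} → T` with `m ∘ ι = u`, `m ∘ σ = v` (the free extension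
kills `r_{g+h} = ι(r_g) · σ(r_h)`). [folklore] -/
theorem surfaceGroup_exists_hom_add {T : Type*} [Group T]
    (u : FreeGroup (surfaceGen g) →* T) (v : FreeGroup (surfaceGen h) →* T)
    (huv : u (surfaceRelator g) * v (surfaceRelator h) = 1) :
    ∃ m : SurfaceGroup (g + h) →* T,
      m.comp ((PresentedGroup.mk _).comp (genInclAdd g h)) = u ∧
        m.comp ((PresentedGroup.mk _).comp (genShiftAdd g h)) = v := by
  have hEr : ∀ r ∈ ({surfaceRelator (g + h)} : Set (FreeGroup (surfaceGen (g + h)))), freeExtend u v r = 1 := by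
    intro r hr
    rw [Set.mem_singleton_iff] at hr
    rw [hr, surfaceRelator_add, map_mul, ← MonoidHom.comp_apply, freeExtend_comp_genInclAdd,
      ← MonoidHom.comp_apply, freeExtend_comp_genShiftAdd, huv]
  refine ⟨presentedLift (freeExtend u v) hEr, ?_, ?_⟩
  · exact MonoidHom.ext fun x => by
      rw [MonoidHom.comp_apply, MonoidHom.comp_apply, presentedLift_mk, ← MonoidHom.comp_apply,
        freeExtend_comp_genInclAdd]
  · exact MonoidHom.ext fun x => by
      rw [MonoidHom.comp_apply, MonoidHom.comp_apply, presentedLift_mk, ← MonoidHom.comp_apply,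
        freeExtend_comp_genShiftAdd]

/-- **Any pushout of `F⟨a₁,…,b_g⟩ ← ℤ → F⟨a₁,…,b_h⟩` (`1 ↦ r_g`, `1 ↦ r_h⁻¹`) is `S_{g+h}`.**  If
`u(r_g) · v(r_h) = 1`, some `F : Γ → S_{g+h}` has `F ∘ u = ι`, `F ∘ v = σ`, and endomorphisms of
`Γ` agreeing on `u` and `v` are equal (the universal property of the pushout, e.g. `Γ = π₁` of a
surface cut along a circle separating `g` handles from `h`, by Seifert–van Kampen with free bases
of the two sides in which the circle reads `r_g` and `r_h⁻¹`), then there is an isomorphism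
`e : S_{g+h} ≃* Γ` with `e ∘ ι = u` and `e ∘ σ = v`. [cite: HatcherAT2002, Thm. 1.20] -/
theorem surfaceGroup_exists_mulEquiv_of_pushout_add {Γ : Type*} [Group Γ]
    (u : FreeGroup (surfaceGen g) →* Γ) (v : FreeGroup (surfaceGen h) →* Γ)
    (huv : u (surfaceRelator g) * v (surfaceRelator h) = 1)
    (hexists : ∃ F : Γ →* SurfaceGroup (g + h),
      F.comp u = (PresentedGroup.mk _).comp (genInclAdd g h) ∧
        F.comp v = (PresentedGroup.mk _).comp (genShiftAdd g h))
    (hunique : ∀ F F' : Γ →* Γ, F.comp u = F'.comp u → F.comp v = F'.comp v → F = F') :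
    ∃ e : SurfaceGroup (g + h) ≃* Γ,
      e.toMonoidHom.comp ((PresentedGroup.mk _).comp (genInclAdd g h)) = u ∧
        e.toMonoidHom.comp ((PresentedGroup.mk _).comp (genShiftAdd g h)) = v := by
  obtain ⟨m, hm₁, hm₂⟩ := surfaceGroup_exists_hom_add u v huv
  obtain ⟨F, hF₁, hF₂⟩ := hexists
  have h1 : F.comp m = MonoidHom.id _ := by
    refine surfaceGroup_hom_ext_add ?_ ?_
    · rw [MonoidHom.comp_assoc, hm₁, hF₁, MonoidHom.id_comp]
    · rw [MonoidHom.comp_assoc, hm₂, hF₂, MonoidHom.id_comp]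
  have h2 : m.comp F = MonoidHom.id _ := by
    refine hunique _ _ ?_ ?_
    · rw [MonoidHom.comp_assoc, hF₁, hm₁, MonoidHom.id_comp]
    · rw [MonoidHom.comp_assoc, hF₂, hm₂, MonoidHom.id_comp]
  exact ⟨MonoidHom.toMulEquiv m F h1 h2, hm₁, hm₂⟩

end Literature.Topology.FourManifolds
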